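import Summits.Ventures.CertifiedManyBodySolver.Downfold.OneBandInPlaneFilling
import HarnessLib

/-!
# The direct one-band in-plane band, IV: the NODAL and ANTINODAL Fermi points — location brackets and certified
# Fermi-velocity windows

Venture CertifiedManyBodySolver, cell `pub/hubbard-downfold` (stage S1, technique B), seat hubbard-downfold-mod-4;
namespace `Summit.Ventures.CertifiedManyBodySolver.Downfold.Emery`. Everything PROVED; no number lives here. WHAT THIS
IS NOT: a statement about any material; `U = 0` one-body kinematics of a one-band Wannier Hamiltonian.

Under `IpAnti` (band increasing along `kx` and along `ky` on the quadrant) the band restricted to the zone DIAGONAL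
`kx = ky` (`u ↦ ε(u, u)`) and to the zone FACE `kx = π` (`v ↦ ε(−1, v)`) is antitone in the cosine, so a Fermi
crossing on either line is located by two exact rational evaluations:

* §1 continuity of the polynomial form; `ipDiag`, `ipFace`.
* §2 `ipNodeBracketCheck S e₁ e₂ ua ub` / `ipFaceBracketCheck S e₁ e₂ va vb`: for every Fermi energy `ε ∈ [e₁, e₂]`,
  every diagonal (face) Fermi point has `cos k ∈ (ua, ub)` (`(va, vb)`) — `node_cos_mem_Ioo`, `face_cos_mem_Ioo` — and
  one EXISTS (`node_exists`, `face_exists`, intermediate value theorem).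
* §3 one-variable kd WINDOW checks (`windowCheck₁`) of the squared Fermi velocity on the bracket: `ipNodeGradSqE`
  (`= |∇ε|²` on the diagonal, `2(1 − u²)(∂_u ε(u,u))²`) and `ipFaceGradSqE` (`= |∇ε|²` on the face,
  `(1 − v²)(∂_u ε(v, −1))²`); composed with the Fermi-energy bracket of `OneBandInPlaneFilling`:
  `ipNode_of_checks` / `ipFace_of_checks` — for every `ε` whose filling lies in `[ν₁, ν₂]` and every nodal /
  antinodal Fermi point, `cos k` lies in the bracket and `|∇ε|² ∈ [w_lo, w_hi]`.

Sources: `t–t′–t″` form, nodal/antinodal geometry [AndersenEtAl1995, §6]; interval verification [Moore1966, Theorem 3.1, §4.4].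
-/

noncomputable section

namespace Summit.Ventures.CertifiedManyBodySolver.Downfold.Emery

open Real Set Literature.Analysis.ValidatedNumerics

/-! ## §1 Continuity; the diagonal and the face restrictions -/

/-- The star polynomial is jointly continuous. [folklore] -/
theorem continuous_starUV₂ (m n : ℕ) : Continuous (fun p : ℝ × ℝ => starUV m n p.1 p.2) := by
  have hc : ∀ j : ℕ, Continuous (fun p : ℝ × ℝ => cheb j p.1) := fun j => (continuous_cheb j).comp continuous_fst
  have hd : ∀ j : ℕ, Continuous (fun p : ℝ × ℝ => cheb j p.2) := fun j => (continuous_cheb j).comp continuous_snd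
  unfold starUV
  split_ifs
  · exact continuous_const
  · exact continuous_const.mul ((hc m).add (hd m))
  · exact continuous_const.mul ((hc m).mul (hd m))
  · exact continuous_const.mul (((hc m).mul (hd n)).add ((hc n).mul (hd m)))

/-- The band polynomial is jointly continuous. [folklore] -/
theorem continuous_ipBandUV₂ (S : List (ℕ × ℕ × ℚ)) : Continuous (fun p : ℝ × ℝ => ipBandUV S p.1 p.2) := by
  induction S with
  | nil => simpa [ipBandUV] using continuous_const
  | cons s S ih =>
    have h : Continuous fun p : ℝ × ℝ => (s.2.2 : ℝ) * starUV s.1 s.2.1 p.1 p.2 + ipBandUV S p.1 p.2 :=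
      ((continuous_const (y := (s.2.2 : ℝ))).mul (continuous_starUV₂ s.1 s.2.1)).add ih
    simpa [ipBandUV, List.map_cons, List.sum_cons] using h

/-- The band on the zone diagonal `kx = ky` as a function of `u = cos k`. [folklore] -/
def ipDiag (S : List (ℕ × ℕ × ℚ)) (u : ℝ) : ℝ := ipBandUV S u u

/-- The band on the zone face `kx = π` as a function of `v = cos ky`. [folklore] -/
def ipFace (S : List (ℕ × ℕ × ℚ)) (v : ℝ) : ℝ := ipBandUV S (-1) v

/-- [folklore] -/
theorem continuous_ipDiag (S : List (ℕ × ℕ × ℚ)) : Continuous (ipDiag S) :=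
  (continuous_ipBandUV₂ S).comp (continuous_id.prodMk continuous_id)

/-- [folklore] -/
theorem continuous_ipFace (S : List (ℕ × ℕ × ℚ)) : Continuous (ipFace S) :=
  (continuous_ipBandUV₂ S).comp (continuous_const.prodMk continuous_id)

/-- On the diagonal the band is `ε(k, k) = ipDiag S (cos k)`. [folklore] -/
theorem ipBandK_diag {S : List (ℕ × ℕ × ℚ)} (hS : shellsOK S = true) (k : ℝ) : ipBandK S k k = ipDiag S (cos k) := by
  rw [ipBandK_eq_UV hS]; rfl

/-- On the face the band is `ε(π, k) = ipFace S (cos k)`. [folklore] -/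
theorem ipBandK_face {S : List (ℕ × ℕ × ℚ)} (hS : shellsOK S = true) (k : ℝ) : ipBandK S π k = ipFace S (cos k) := by
  rw [ipBandK_eq_UV hS, cos_pi]; rfl

/-! ## §2 Brackets of the nodal and antinodal Fermi points -/

/-- NODE BRACKET CHECK: `−1 ≤ ua < ub ≤ 1`, `ε(ub, ub) < e₁` and `e₂ < ε(ua, ua)`. [folklore] -/
def ipNodeBracketCheck (S : List (ℕ × ℕ × ℚ)) (e₁ e₂ ua ub : ℚ) : Bool :=
  decide (-1 ≤ ua) && decide (ua < ub) && decide (ub ≤ 1) &&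
  decide (ipBandQ S ub ub < e₁) && decide (e₂ < ipBandQ S ua ua)

/-- FACE BRACKET CHECK: `−1 ≤ va < vb ≤ 1`, `ε(−1, vb) < e₁` and `e₂ < ε(−1, va)`. [folklore] -/
def ipFaceBracketCheck (S : List (ℕ × ℕ × ℚ)) (e₁ e₂ va vb : ℚ) : Bool :=
  decide (-1 ≤ va) && decide (va < vb) && decide (vb ≤ 1) &&
  decide (ipBandQ S (-1) vb < e₁) && decide (e₂ < ipBandQ S (-1) va)

/-- **Every diagonal Fermi point lies in the node bracket**: `cos k ∈ (ua, ub)`. [folklore] -/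
theorem node_cos_mem_Ioo {S : List (ℕ × ℕ × ℚ)} (hA : IpAnti S) {e₁ e₂ ua ub : ℚ}
    (h : ipNodeBracketCheck S e₁ e₂ ua ub = true) {ε : ℝ} (hε : ε ∈ Icc (e₁ : ℝ) e₂)
    {u : ℝ} (hu : u ∈ Icc (-1 : ℝ) 1) (hF : ipDiag S u = ε) : u ∈ Ioo (ua : ℝ) ub := by
  simp only [ipNodeBracketCheck, Bool.and_eq_true, decide_eq_true_eq] at h
  obtain ⟨⟨⟨⟨ha, hab⟩, hb⟩, hhi⟩, hlo⟩ := h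
  have ha' : (-1 : ℝ) ≤ ua := by exact_mod_cast ha
  have hb' : (ub : ℝ) ≤ 1 := by exact_mod_cast hb
  have hab' : (ua : ℝ) < ub := by exact_mod_cast hab
  have hhi' := (Rat.cast_lt (K := ℝ)).2 hhi
  have hlo' := (Rat.cast_lt (K := ℝ)).2 hlo
  rw [cast_ipBandQ] at hhi' hlo'
  have hua : (ua : ℝ) ∈ Icc (-1 : ℝ) 1 := ⟨ha', hab'.le.trans hb'⟩
  have hub : (ub : ℝ) ∈ Icc (-1 : ℝ) 1 := ⟨ha'.trans hab'.le, hb'⟩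
  unfold ipDiag at hF
  constructor
  · by_contra hle
    have hle := not_lt.1 hle
    have := hA hu hu hua hua hle hle
    linarith [hε.2]
  · by_contra hle
    have hle := not_lt.1 hle
    have := hA hub hub hu hu hle hle
    linarith [hε.1]

/-- **Every face Fermi point lies in the face bracket**: `cos k ∈ (va, vb)`. [folklore] -/
theorem face_cos_mem_Ioo {S : List (ℕ × ℕ × ℚ)} (hA : IpAnti S) {e₁ e₂ va vb : ℚ}
    (h : ipFaceBracketCheck S e₁ e₂ va vb = true) {ε : ℝ} (hε : ε ∈ Icc (e₁ : ℝ) e₂)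
    {v : ℝ} (hv : v ∈ Icc (-1 : ℝ) 1) (hF : ipFace S v = ε) : v ∈ Ioo (va : ℝ) vb := by
  simp only [ipFaceBracketCheck, Bool.and_eq_true, decide_eq_true_eq] at h
  obtain ⟨⟨⟨⟨ha, hab⟩, hb⟩, hhi⟩, hlo⟩ := h
  have ha' : (-1 : ℝ) ≤ va := by exact_mod_cast ha
  have hb' : (vb : ℝ) ≤ 1 := by exact_mod_cast hb
  have hab' : (va : ℝ) < vb := by exact_mod_cast hab
  have hhi' := (Rat.cast_lt (K := ℝ)).2 hhi
  have hlo' := (Rat.cast_lt (K := ℝ)).2 hlo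
  rw [cast_ipBandQ] at hhi' hlo'
  push_cast at hhi' hlo'
  have hva : (va : ℝ) ∈ Icc (-1 : ℝ) 1 := ⟨ha', hab'.le.trans hb'⟩
  have hvb : (vb : ℝ) ∈ Icc (-1 : ℝ) 1 := ⟨ha'.trans hab'.le, hb'⟩
  have hm1 : (-1 : ℝ) ∈ Icc (-1 : ℝ) 1 := by norm_num
  unfold ipFace at hF
  constructor
  · by_contra hle
    have hle := not_lt.1 hle
    have := hA hm1 hv hm1 hva le_rfl hle
    linarith [hε.2]
  · by_contra hle
    have hle := not_lt.1 hle
    have := hA hm1 hvb hm1 hv le_rfl hle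
    linarith [hε.1]

/-- **A nodal Fermi point EXISTS** for every `ε ∈ [e₁, e₂]` (intermediate value theorem). [folklore] -/
theorem node_exists {S : List (ℕ × ℕ × ℚ)} (hA : IpAnti S) {e₁ e₂ ua ub : ℚ}
    (h : ipNodeBracketCheck S e₁ e₂ ua ub = true) {ε : ℝ} (hε : ε ∈ Icc (e₁ : ℝ) e₂) :
    ∃ u ∈ Ioo (ua : ℝ) ub, ipDiag S u = ε := by
  have h0 := h
  simp only [ipNodeBracketCheck, Bool.and_eq_true, decide_eq_true_eq] at h
  obtain ⟨⟨⟨⟨ha, hab⟩, hb⟩, hhi⟩, hlo⟩ := h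
  have hhi' := (Rat.cast_lt (K := ℝ)).2 hhi
  have hlo' := (Rat.cast_lt (K := ℝ)).2 hlo
  rw [cast_ipBandQ] at hhi' hlo'
  have hab' : (ua : ℝ) ≤ ub := by exact_mod_cast hab.le
  have hsub := intermediate_value_Icc' hab' (continuous_ipDiag S).continuousOn
  have hmem : ε ∈ Icc (ipDiag S ub) (ipDiag S ua) := by
    unfold ipDiag; exact ⟨by linarith [hε.1], by linarith [hε.2]⟩
  obtain ⟨u, hu, hfu⟩ := hsub hmem
  have hu1 : u ∈ Icc (-1 : ℝ) 1 :=
    ⟨le_trans (by exact_mod_cast ha) hu.1, hu.2.trans (by exact_mod_cast hb)⟩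
  exact ⟨u, node_cos_mem_Ioo hA h0 hε hu1 hfu, hfu⟩

/-- **An antinodal (face) Fermi point EXISTS** for every `ε ∈ [e₁, e₂]`. [folklore] -/
theorem face_exists {S : List (ℕ × ℕ × ℚ)} (hA : IpAnti S) {e₁ e₂ va vb : ℚ}
    (h : ipFaceBracketCheck S e₁ e₂ va vb = true) {ε : ℝ} (hε : ε ∈ Icc (e₁ : ℝ) e₂) :
    ∃ v ∈ Ioo (va : ℝ) vb, ipFace S v = ε := by
  have h0 := h
  simp only [ipFaceBracketCheck, Bool.and_eq_true, decide_eq_true_eq] at h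
  obtain ⟨⟨⟨⟨ha, hab⟩, hb⟩, hhi⟩, hlo⟩ := h
  have hhi' := (Rat.cast_lt (K := ℝ)).2 hhi
  have hlo' := (Rat.cast_lt (K := ℝ)).2 hlo
  rw [cast_ipBandQ] at hhi' hlo'
  push_cast at hhi' hlo'
  have hab' : (va : ℝ) ≤ vb := by exact_mod_cast hab.le
  have hsub := intermediate_value_Icc' hab' (continuous_ipFace S).continuousOn
  have hmem : ε ∈ Icc (ipFace S vb) (ipFace S va) := by
    unfold ipFace; exact ⟨by linarith [hε.1], by linarith [hε.2]⟩
  obtain ⟨v, hv, hfv⟩ := hsub hmem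
  have hv1 : v ∈ Icc (-1 : ℝ) 1 :=
    ⟨le_trans (by exact_mod_cast ha) hv.1, hv.2.trans (by exact_mod_cast hb)⟩
  exact ⟨v, face_cos_mem_Ioo hA h0 hε hv1 hfv, hfv⟩

/-! ## §3 Velocity windows on the brackets -/

/-- `|∇ε|²` on the diagonal as a one-variable `ArithExpr` (`x 0 = u`): `2(1 − u²)(∂_u ε(u, u))²`. [folklore] -/
def ipNodeGradSqE (S : List (ℕ × ℕ × ℚ)) : ArithExpr :=
  .mul (.const 2) (.mul (.sub (.const 1) (.mul (.var 0) (.var 0)))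
    (.mul (ipBandUGE S (.var 0) (.var 0)) (ipBandUGE S (.var 0) (.var 0))))

/-- `|∇ε|²` on the face as a one-variable `ArithExpr` (`x 0 = v`): `(1 − v²)(∂_u ε(v, −1))²`. [folklore] -/
def ipFaceGradSqE (S : List (ℕ × ℕ × ℚ)) : ArithExpr :=
  .mul (.sub (.const 1) (.mul (.var 0) (.var 0)))
    (.mul (ipBandUGE S (.var 0) (.const (-1))) (ipBandUGE S (.var 0) (.const (-1))))

/-- [folklore] -/
theorem eval_ipNodeGradSqE (S : List (ℕ × ℕ × ℚ)) (x : ℕ → ℝ) :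
    (ipNodeGradSqE S).eval x = ipGradSqUV S (x 0) (x 0) := by
  simp [ipNodeGradSqE, eval_ipBandUGE, ipGradSqUV_diag]; ring

/-- [folklore] -/
theorem eval_ipFaceGradSqE (S : List (ℕ × ℕ × ℚ)) (x : ℕ → ℝ) :
    (ipFaceGradSqE S).eval x = ipGradSqUV S (-1) (x 0) := by
  simp [ipFaceGradSqE, eval_ipBandUGE, ipGradSqUV_face]; ring

/-- ONE-VARIABLE WINDOW CHECK of an expression on `[lo, hi]`: kd certificates for `e ≤ whi` and `−e ≤ −wlo`.
[cite: Moore1966, Theorem 3.1, §4.4] -/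
def windowCheck₁ (e : ArithExpr) (lo hi wlo whi : ℚ) (t₁ t₂ : KdCert ℕ) : Bool :=
  t₁.check (exprLeOn e whi) [(lo, hi)] && t₂.check (exprLeOn (.neg e) (-wlo)) [(lo, hi)]

/-- **Soundness of the one-variable window check.** [cite: Moore1966, Theorem 3.1, §4.4] -/
theorem window_of_check₁ {e : ArithExpr} {lo hi wlo whi : ℚ} {t₁ t₂ : KdCert ℕ}
    (h : windowCheck₁ e lo hi wlo whi t₁ t₂ = true) {u : ℝ} (hu : u ∈ Icc (lo : ℝ) hi) :
    e.eval (fun i => if i = 0 then u else 0) ∈ Icc (wlo : ℝ) whi := by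
  simp only [windowCheck₁, Bool.and_eq_true] at h
  have hmem : Box.mem [(lo, hi)] (fun i => if i = 0 then u else 0) := by
    intro i
    match i with
    | 0 => simpa [Box.ivl] using hu
    | k + 1 => simp [Box.ivl]
  have h1 := eval_le_of_kdCheck h.1 _ hmem
  have h2 := eval_le_of_kdCheck h.2 _ hmem
  simp only [ArithExpr.eval_neg, Rat.cast_neg, neg_le_neg_iff] at h2
  exact ⟨h2, h1⟩

/-- **THE NODAL POINT THEOREM.** Shell list with a passing monotonicity certificate, a Fermi-energy bracket `[e₁, e₂]`
of the filling window `[ν₁, ν₂]`, a node bracket `(ua, ub)` and a velocity window on it: for every Fermi energy `ε` with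
`ipFilling S ε ∈ [ν₁, ν₂]` and every diagonal momentum `k ∈ [0, π]` ON THE FERMI SURFACE (`ε(k, k) = ε`),
`cos k ∈ (ua, ub)` and the squared Fermi velocity `|∇ε|²(k, k) ∈ [w_lo, w_hi]`. [folklore] -/
theorem ipNode_of_checks {K : ℕ} (hK : 0 < K) {xl xh : ℕ → ℚ} (hG : GridEncl K xl xh)
    {S : List (ℕ × ℕ × ℚ)} (hS : shellsOK S = true) {tm : KdCert ℕ}
    (hm : ipMonoKdCheck S tm = true) {e₁ e₂ ν₁ ν₂ ua ub wlo whi : ℚ} {jout jin : List ℕ} {t₁ t₂ : KdCert ℕ}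
    (hbr : ipBracketCheckG K xl xh S e₁ e₂ ν₁ ν₂ jout jin = true) (hnb : ipNodeBracketCheck S e₁ e₂ ua ub = true)
    (hw : windowCheck₁ (ipNodeGradSqE S) ua ub wlo whi t₁ t₂ = true)
    {ε : ℝ} (hν : ipFilling S ε ∈ Icc (ν₁ : ℝ) ν₂) {k : ℝ} (hF : ipBandK S k k = ε) :
    cos k ∈ Ioo (ua : ℝ) ub ∧ ipGradSq S k k ∈ Icc (wlo : ℝ) whi := by
  have hA := ipAnti_of_kdCheck hm
  have hε := fermi_mem_Icc_of_ipBracketCheck hK hG hS hA hbr hν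
  rw [ipBandK_diag hS] at hF
  have hu := node_cos_mem_Ioo hA hnb hε ⟨neg_one_le_cos k, cos_le_one k⟩ hF
  refine ⟨hu, ?_⟩
  have hwin := window_of_check₁ hw (Ioo_subset_Icc_self hu)
  rw [eval_ipNodeGradSqE] at hwin
  simpa [ipGradSq_eq_UV] using hwin

/-- **THE ANTINODAL (FACE) POINT THEOREM**: same on the zone face `kx = π` (`ε(π, k) = ε`): `cos k ∈ (va, vb)` and
`|∇ε|²(π, k) ∈ [w_lo, w_hi]`. [folklore] -/
theorem ipFace_of_checks {K : ℕ} (hK : 0 < K) {xl xh : ℕ → ℚ} (hG : GridEncl K xl xh)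
    {S : List (ℕ × ℕ × ℚ)} (hS : shellsOK S = true) {tm : KdCert ℕ}
    (hm : ipMonoKdCheck S tm = true) {e₁ e₂ ν₁ ν₂ va vb wlo whi : ℚ} {jout jin : List ℕ} {t₁ t₂ : KdCert ℕ}
    (hbr : ipBracketCheckG K xl xh S e₁ e₂ ν₁ ν₂ jout jin = true) (hfb : ipFaceBracketCheck S e₁ e₂ va vb = true)
    (hw : windowCheck₁ (ipFaceGradSqE S) va vb wlo whi t₁ t₂ = true)
    {ε : ℝ} (hν : ipFilling S ε ∈ Icc (ν₁ : ℝ) ν₂) {k : ℝ} (hF : ipBandK S π k = ε) :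
    cos k ∈ Ioo (va : ℝ) vb ∧ ipGradSq S π k ∈ Icc (wlo : ℝ) whi := by
  have hA := ipAnti_of_kdCheck hm
  have hε := fermi_mem_Icc_of_ipBracketCheck hK hG hS hA hbr hν
  rw [ipBandK_face hS] at hF
  have hv := face_cos_mem_Ioo hA hfb hε ⟨neg_one_le_cos k, cos_le_one k⟩ hF
  refine ⟨hv, ?_⟩
  have hwin := window_of_check₁ hw (Ioo_subset_Icc_self hv)
  rw [eval_ipFaceGradSqE] at hwin
  simpa [ipGradSq_eq_UV, cos_pi] using hwin

/-- **Existence at a filling**: for every `ε` whose filling lies in `[ν₁, ν₂]` there IS a nodal Fermi momentum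
`k ∈ [0, π]` on the diagonal and an antinodal one on the face (so the windows above are not vacuous). [folklore] -/
theorem ipNode_face_exist {K : ℕ} (hK : 0 < K) {xl xh : ℕ → ℚ} (hG : GridEncl K xl xh)
    {S : List (ℕ × ℕ × ℚ)} (hS : shellsOK S = true) {tm : KdCert ℕ}
    (hm : ipMonoKdCheck S tm = true) {e₁ e₂ ν₁ ν₂ ua ub va vb : ℚ} {jout jin : List ℕ}
    (hbr : ipBracketCheckG K xl xh S e₁ e₂ ν₁ ν₂ jout jin = true) (hnb : ipNodeBracketCheck S e₁ e₂ ua ub = true)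
    (hfb : ipFaceBracketCheck S e₁ e₂ va vb = true)
    {ε : ℝ} (hν : ipFilling S ε ∈ Icc (ν₁ : ℝ) ν₂) :
    (∃ k ∈ Icc (0 : ℝ) π, ipBandK S k k = ε) ∧ (∃ k ∈ Icc (0 : ℝ) π, ipBandK S π k = ε) := by
  have hA := ipAnti_of_kdCheck hm
  have hε := fermi_mem_Icc_of_ipBracketCheck hK hG hS hA hbr hν
  have hn := hnb; have hf := hfb
  simp only [ipNodeBracketCheck, ipFaceBracketCheck, Bool.and_eq_true, decide_eq_true_eq] at hn hf
  constructor
  · obtain ⟨u, hu, hfu⟩ := node_exists hA hnb hε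
    have hu1 : -1 ≤ u := le_trans (by exact_mod_cast hn.1.1.1.1) hu.1.le
    have hu2 : u ≤ 1 := hu.2.le.trans (by exact_mod_cast hn.1.1.2)
    refine ⟨arccos u, ⟨arccos_nonneg u, arccos_le_pi u⟩, ?_⟩
    rw [ipBandK_diag hS, cos_arccos hu1 hu2]; exact hfu
  · obtain ⟨v, hv, hfv⟩ := face_exists hA hfb hε
    have hv1 : -1 ≤ v := le_trans (by exact_mod_cast hf.1.1.1.1) hv.1.le
    have hv2 : v ≤ 1 := hv.2.le.trans (by exact_mod_cast hf.1.1.2)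
    refine ⟨arccos v, ⟨arccos_nonneg v, arccos_le_pi v⟩, ?_⟩
    rw [ipBandK_face hS, cos_arccos hv1 hv2]; exact hfv

end Summit.Ventures.CertifiedManyBodySolver.Downfold.Emery
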